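import Mathlib
import Summits.RiemannHypothesis.RiemannHypothesis.Theorems.IntegerScrewExitAtom
import Summits.RiemannHypothesis.RiemannHypothesis.Theorems.IntegerScrewWalkPoincareAtom
import HarnessLib

/-!
# Route `IntegerScrew` — THEOREM B/C's assembly on the `p`-free atom: flow + residual
# (CONTINUUM-LIMIT §25.10 (e), §25.11 (c) in the kernel; the atom version of `IntegerScrewExitAssembly`)

Notation of `IntegerScrewExitAtomGreen`/`IntegerScrewExitAtom`: `𝒜 = Nat.smoothNumbers p ∩ [1, R]`,
`W = 𝒜 ∩ (Q, R]`, `B = 𝒜 ∩ [1, Q]`, `ν^𝒜 = exitInflowAtom R Q p`, `D_𝒜(g)` the atom's internal Dirichlet form.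
The window functional of THEOREM P₀'s cell is `Σ_W g/x − c_𝒜·Σ_B g/b` with the mass ratio
`c_𝒜 = (Σ_W 1/x)/(Σ_B 1/b)`; it splits as `[Σ_W g/x − Σ_B ν^𝒜 g]` (the exit flow, `exit_flow_cauchy_schwarz_atom`)
plus the RESIDUAL `Σ_B (ν^𝒜(b) − c_𝒜/b)·g(b)`, a zero-mass signed measure on `B` (conservation
`sum_exitInflowAtom_eq`), priced by its χ² against the harmonic measure of `B` and PROP. 24.7 ON THE ATOM
(`walk_poincare_mertens_dirichlet_atom`):

* `exitMassRatioAtom`, `exitChiSqAtom` (`χ²_𝒜 = Σ_B b·(ν^𝒜(b) − c_𝒜/b)²`), `sum_exitInflowAtom_sub_eq_zero`;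
* `exit_residual_sq_le_atom` — `(Σ_B (ν^𝒜 − c_𝒜/b) g)² ≤ χ²_𝒜 · Σ_B (1/b)(g b − g 1)²`;
* **`window_functional_sq_le_atom`** — for `2 ≤ Q ≤ R`, `A ≥ 1`, `A(1 − (39/50)log R/log²(Q+1)) ≥ 1`, a Mertens
  constant `C`, every `p` and every `g`:
  `(Σ_W g/x − c_𝒜·Σ_B g/b)² ≤ 2·[A² log²R·(1/(2log²Q) − 1/(2log²R)) + χ²_𝒜·⌊log₂Q⌋·C]·D_𝒜(g)` (PROP. 24.7 on the bottom: `⌊log₂Q⌋`) —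
  THEOREM B/C's `κ ≤ 2κ_F + 2κ_res` on every window of every `p`-free atom, with THEOREM P₀'s OWN Dirichlet
  form on the right; `window_functional_sq_le_atom_exp_five` (`C = e⁵`).  What remains for THEOREM B is the
  bound on `χ²_𝒜` (the tilt, 25.10 (b)–(d)); for the all-integer atom (`p > R`) this is `exitChiSq_le`.

RH-free, elementary.  Nothing in this file bears on the truth of RH.
References: CONTINUUM-LIMIT §25.10–25.11 (rh-explicit A6-PIVOT); M. Suzuki, J. Lond. Math. Soc. (2) 108 (2023)
1448–1487 [Suzuki2023].
-/

noncomputable section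

set_option linter.dupNamespace false -- D-0017: `Summit.<S>.<S>.…` is the designed namespace

namespace Summit.RiemannHypothesis.RiemannHypothesis.Theorems.IntegerScrew

open Finset Real
open ArithmeticFunction (vonMangoldt)

/-! ### The residual and its χ² on the atom -/

/-- The atom's mass ratio `c_𝒜 = (Σ_{x∈W} 1/x)/(Σ_{b∈B} 1/b)`.
[cite: Suzuki2023, §1 (the screw matrices S_M whose pivot/spectral theory this serves)] -/
def exitMassRatioAtom (R Q p : ℕ) : ℝ :=
  (∑ x ∈ (Ioc Q R).filter (· ∈ Nat.smoothNumbers p), (1 : ℝ) / x) /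
    ∑ b ∈ (Icc 1 Q).filter (· ∈ Nat.smoothNumbers p), (1 : ℝ) / b

/-- The unnormalised χ² of the atom's exit density against the harmonic measure of `B`:
`Σ_{b∈B} b·(ν^𝒜(b) − c_𝒜/b)²`.
[cite: Suzuki2023, §1 (the screw matrices S_M whose pivot/spectral theory this serves)] -/
def exitChiSqAtom (R Q p : ℕ) : ℝ :=
  ∑ b ∈ (Icc 1 Q).filter (· ∈ Nat.smoothNumbers p),
    (b : ℝ) * (exitInflowAtom R Q p b - exitMassRatioAtom R Q p / b) ^ 2

/-- `χ²_𝒜 ≥ 0`. -/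
theorem exitChiSqAtom_nonneg (R Q p : ℕ) : 0 ≤ exitChiSqAtom R Q p :=
  Finset.sum_nonneg fun _ _ => mul_nonneg (Nat.cast_nonneg _) (sq_nonneg _)

/-- The harmonic mass of `B` is positive (`1 ∈ B`). -/
theorem sum_inv_bottom_atom_pos {Q : ℕ} (p : ℕ) (hQ : 1 ≤ Q) :
    0 < ∑ b ∈ (Icc 1 Q).filter (· ∈ Nat.smoothNumbers p), (1 : ℝ) / b :=
  Finset.sum_pos (fun b hb => by have := (Finset.mem_Icc.1 (Finset.mem_filter.1 hb).1).1; positivity)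
    ⟨1, Finset.mem_filter.2 ⟨by simp [hQ], Literature.NumberTheory.LFunctions.Halasz.one_mem_smoothNumbers p⟩⟩

/-- The residual has mass zero: `Σ_{b∈B} (ν^𝒜(b) − c_𝒜/b) = 0` (`1 ≤ Q ≤ R`). -/
theorem sum_exitInflowAtom_sub_eq_zero {R Q : ℕ} (p : ℕ) (hQ : 1 ≤ Q) (hQR : Q ≤ R) :
    ∑ b ∈ (Icc 1 Q).filter (· ∈ Nat.smoothNumbers p), (exitInflowAtom R Q p b - exitMassRatioAtom R Q p / b) = 0 := by
  rw [Finset.sum_sub_distrib, sum_exitInflowAtom_eq p hQ hQR]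
  unfold exitMassRatioAtom
  have hH := sum_inv_bottom_atom_pos (Q := Q) p hQ
  have : ∑ b ∈ (Icc 1 Q).filter (· ∈ Nat.smoothNumbers p),
      (∑ x ∈ (Ioc Q R).filter (· ∈ Nat.smoothNumbers p), (1 : ℝ) / x) /
        (∑ b ∈ (Icc 1 Q).filter (· ∈ Nat.smoothNumbers p), (1 : ℝ) / b) / (b : ℝ) =
      ((∑ x ∈ (Ioc Q R).filter (· ∈ Nat.smoothNumbers p), (1 : ℝ) / x) /
        ∑ b ∈ (Icc 1 Q).filter (· ∈ Nat.smoothNumbers p), (1 : ℝ) / b) *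
        ∑ b ∈ (Icc 1 Q).filter (· ∈ Nat.smoothNumbers p), (1 : ℝ) / b := by
    rw [Finset.mul_sum]; exact Finset.sum_congr rfl fun b _ => by ring
  rw [this, div_mul_cancel₀ _ hH.ne', sub_self]

/-- **The residual against a test function, by Cauchy–Schwarz**:
`(Σ_{b∈B} (ν^𝒜(b) − c_𝒜/b) g(b))² ≤ χ²_𝒜 · Σ_{b∈B} (1/b)(g(b) − g(1))²` (`1 ≤ Q ≤ R`). -/
theorem exit_residual_sq_le_atom {R Q : ℕ} (p : ℕ) (hQ : 1 ≤ Q) (hQR : Q ≤ R) (g : ℕ → ℝ) :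
    (∑ b ∈ (Icc 1 Q).filter (· ∈ Nat.smoothNumbers p),
        (exitInflowAtom R Q p b - exitMassRatioAtom R Q p / b) * g b) ^ 2 ≤
      exitChiSqAtom R Q p * ∑ b ∈ (Icc 1 Q).filter (· ∈ Nat.smoothNumbers p), (1 / (b : ℝ)) * (g b - g 1) ^ 2 := by
  have hre : ∑ b ∈ (Icc 1 Q).filter (· ∈ Nat.smoothNumbers p),
      (exitInflowAtom R Q p b - exitMassRatioAtom R Q p / b) * g b =
      ∑ b ∈ (Icc 1 Q).filter (· ∈ Nat.smoothNumbers p),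
        (exitInflowAtom R Q p b - exitMassRatioAtom R Q p / b) * (g b - g 1) := by
    have h0 := sum_exitInflowAtom_sub_eq_zero (R := R) p hQ hQR
    have : ∑ b ∈ (Icc 1 Q).filter (· ∈ Nat.smoothNumbers p),
        (exitInflowAtom R Q p b - exitMassRatioAtom R Q p / b) * (g b - g 1) =
        ∑ b ∈ (Icc 1 Q).filter (· ∈ Nat.smoothNumbers p),
          (exitInflowAtom R Q p b - exitMassRatioAtom R Q p / b) * g b -
          g 1 * ∑ b ∈ (Icc 1 Q).filter (· ∈ Nat.smoothNumbers p),
            (exitInflowAtom R Q p b - exitMassRatioAtom R Q p / b) := by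
      rw [Finset.mul_sum, ← Finset.sum_sub_distrib]
      exact Finset.sum_congr rfl fun b _ => by ring
    rw [this, h0, mul_zero, sub_zero]
  rw [hre]
  unfold exitChiSqAtom
  refine Finset.sum_sq_le_sum_mul_sum_of_sq_le_mul _ (fun b hb => ?_) (fun b hb => ?_)
    (fun b hb => le_of_eq ?_)
  · have := (Finset.mem_Icc.1 (Finset.mem_filter.1 hb).1).1; positivity
  · positivity
  · have hb0 : (b : ℝ) ≠ 0 := by have := (Finset.mem_Icc.1 (Finset.mem_filter.1 hb).1).1; positivity
    field_simp

/-! ### The assembly on the atom -/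

/-- **THEOREMS B/C, kernel skeleton on the `p`-free atom (CONTINUUM-LIMIT §25.10 (e), §25.11 (c)).**
For `2 ≤ Q ≤ R`, the pointwise Green bound `Γ ≤ A log R/log x` on `(Q, R]`, a Mertens constant `C` with
`Π_{q≤r}(1 − 1/q)⁻¹ ≤ C·log r` for every prime `r ≤ R`, every `p` and every `g : ℕ → ℝ`:
`(Σ_{x∈W} g(x)/x − c_𝒜·Σ_{b∈B} g(b)/b)² ≤ 2·[A² log²R·(1/(2log²Q) − 1/(2log²R)) + χ²_𝒜·⌊log₂Q⌋·C]·D_𝒜(g)`. -/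
theorem window_functional_sq_le_atom {R Q : ℕ} (p : ℕ) (hQ : 2 ≤ Q) (hQR : Q ≤ R) {A : ℝ}
    (hΓU : ∀ x, Q < x → x ≤ R → exitGamma R Q x ≤ A * Real.log R / Real.log x) {C : ℝ}
    (hC : ∀ r : ℕ, r.Prime → r ≤ R → ∏ q ∈ (r + 1).primesBelow, (1 - 1 / (q : ℝ))⁻¹ ≤ C * Real.log r)
    (g : ℕ → ℝ) :
    (∑ x ∈ (Ioc Q R).filter (· ∈ Nat.smoothNumbers p), g x / x -
        exitMassRatioAtom R Q p * ∑ b ∈ (Icc 1 Q).filter (· ∈ Nat.smoothNumbers p), g b / b) ^ 2 ≤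
      2 * (A ^ 2 * Real.log R ^ 2 * (1 / (2 * Real.log Q ^ 2) - 1 / (2 * Real.log R ^ 2)) +
        exitChiSqAtom R Q p * ((Nat.log 2 Q : ℝ) * C)) *
        ∑ x ∈ (Icc 1 R).filter (· ∈ Nat.smoothNumbers p),
          (1 / (x : ℝ)) * ∑ n ∈ x.divisors, vonMangoldt n * (g x - g (x / n)) ^ 2 := by
  have hQ1 : 1 ≤ Q := by omega
  set D := ∑ x ∈ (Icc 1 R).filter (· ∈ Nat.smoothNumbers p),
    (1 / (x : ℝ)) * ∑ n ∈ x.divisors, vonMangoldt n * (g x - g (x / n)) ^ 2 with hD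
  have hDnn : 0 ≤ D := Finset.sum_nonneg fun x _ => mul_nonneg (by positivity)
    (Finset.sum_nonneg fun n _ => mul_nonneg ArithmeticFunction.vonMangoldt_nonneg (sq_nonneg _))
  set F := ∑ x ∈ (Ioc Q R).filter (· ∈ Nat.smoothNumbers p), g x / x -
    ∑ b ∈ (Icc 1 Q).filter (· ∈ Nat.smoothNumbers p), exitInflowAtom R Q p b * g b with hF
  set Res := ∑ b ∈ (Icc 1 Q).filter (· ∈ Nat.smoothNumbers p),
    (exitInflowAtom R Q p b - exitMassRatioAtom R Q p / b) * g b with hRes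
  have hsplit : ∑ x ∈ (Ioc Q R).filter (· ∈ Nat.smoothNumbers p), g x / x -
      exitMassRatioAtom R Q p * ∑ b ∈ (Icc 1 Q).filter (· ∈ Nat.smoothNumbers p), g b / b = F + Res := by
    simp only [hF, hRes, Finset.mul_sum]
    have : ∑ b ∈ (Icc 1 Q).filter (· ∈ Nat.smoothNumbers p),
        (exitInflowAtom R Q p b - exitMassRatioAtom R Q p / b) * g b =
        ∑ b ∈ (Icc 1 Q).filter (· ∈ Nat.smoothNumbers p), exitInflowAtom R Q p b * g b -
          ∑ b ∈ (Icc 1 Q).filter (· ∈ Nat.smoothNumbers p), exitMassRatioAtom R Q p * (g b / b) := by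
      rw [← Finset.sum_sub_distrib]; exact Finset.sum_congr rfl fun b _ => by ring
    rw [this]; ring
  have hFsq : F ^ 2 ≤ A ^ 2 * Real.log R ^ 2 * (1 / (2 * Real.log Q ^ 2) - 1 / (2 * Real.log R ^ 2)) * D :=
    exit_flow_cauchy_schwarz_atom_explicit p hQ hQR hΓU g
  have hRsq : Res ^ 2 ≤ exitChiSqAtom R Q p * ((Nat.log 2 Q : ℝ) * C) * D := by
    have h1 := exit_residual_sq_le_atom (R := R) p hQ1 hQR g
    -- PROP. 24.7 on the BOTTOM atom 𝒜 ∩ [1, Q] (Poincaré constant ⌊log₂Q⌋·C), then D_{𝒜_Q} ≤ D_𝒜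
    have h3 := walk_poincare_mertens_dirichlet_atom Q p g (fun r hr hrQ => hC r hr (hrQ.trans hQR))
    have hC0 : 0 ≤ C := by
      have h := hC 2 Nat.prime_two (hQ.trans hQR)
      have h1' := one_le_prod_primesBelow_inv (2 + 1)
      have hl : 0 < Real.log 2 := Real.log_pos (by norm_num)
      nlinarith
    have h4 : ∑ x ∈ (Icc 1 Q).filter (· ∈ Nat.smoothNumbers p),
        (1 / (x : ℝ)) * ∑ n ∈ x.divisors, vonMangoldt n * (g x - g (x / n)) ^ 2 ≤ D := by
      refine Finset.sum_le_sum_of_subset_of_nonneg ?_ fun x _ _ => mul_nonneg (by positivity)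
        (Finset.sum_nonneg fun n _ => mul_nonneg ArithmeticFunction.vonMangoldt_nonneg (sq_nonneg _))
      intro x hx
      simp only [Finset.mem_filter, Finset.mem_Icc] at hx ⊢
      exact ⟨⟨hx.1.1, hx.1.2.trans hQR⟩, hx.2⟩
    have hχ := exitChiSqAtom_nonneg R Q p
    have hK : 0 ≤ (Nat.log 2 Q : ℝ) * C := mul_nonneg (Nat.cast_nonneg _) hC0
    calc Res ^ 2 ≤ exitChiSqAtom R Q p *
          ∑ b ∈ (Icc 1 Q).filter (· ∈ Nat.smoothNumbers p), (1 / (b : ℝ)) * (g b - g 1) ^ 2 := h1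
      _ ≤ exitChiSqAtom R Q p * (((Nat.log 2 Q : ℝ) * C) * D) :=
          mul_le_mul_of_nonneg_left (h3.trans (mul_le_mul_of_nonneg_left h4 hK)) hχ
      _ = exitChiSqAtom R Q p * ((Nat.log 2 Q : ℝ) * C) * D := by ring
  rw [hsplit]
  nlinarith [sq_nonneg (F - Res), hFsq, hRsq]

/-- **THEOREMS B/C, kernel skeleton on the atom, unconditional Mertens constant `e⁵`.** -/
theorem window_functional_sq_le_atom_exp_five {R Q : ℕ} (p : ℕ) (hQ : 2 ≤ Q) (hQR : Q ≤ R) {A : ℝ}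
    (hΓU : ∀ x, Q < x → x ≤ R → exitGamma R Q x ≤ A * Real.log R / Real.log x) (g : ℕ → ℝ) :
    (∑ x ∈ (Ioc Q R).filter (· ∈ Nat.smoothNumbers p), g x / x -
        exitMassRatioAtom R Q p * ∑ b ∈ (Icc 1 Q).filter (· ∈ Nat.smoothNumbers p), g b / b) ^ 2 ≤
      2 * (A ^ 2 * Real.log R ^ 2 * (1 / (2 * Real.log Q ^ 2) - 1 / (2 * Real.log R ^ 2)) +
        exitChiSqAtom R Q p * ((Nat.log 2 Q : ℝ) * Real.exp 5)) *
        ∑ x ∈ (Icc 1 R).filter (· ∈ Nat.smoothNumbers p),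
          (1 / (x : ℝ)) * ∑ n ∈ x.divisors, vonMangoldt n * (g x - g (x / n)) ^ 2 :=
  window_functional_sq_le_atom p hQ hQR hΓU (fun _ hr _ => prod_primesBelow_inv_le_exp_five_mul_log hr) g

end Summit.RiemannHypothesis.RiemannHypothesis.Theorems.IntegerScrew

end
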